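import Summits.FinalStateConjecture.FinalStateConjecture.Theorems.InertialRecession.Negative.ExpandingChargeWitness

/-!
# Negative knowledge for the crux `InertialRecession` (item stmt-FinalStateConjecture-10166), IX:
# load-bearing hypotheses of `stub_expandingChargeKinematics` (S4, line `old-light-leaves-the-cone`)

Refuter file (D-0016 negative lane, `--supports stmt-FinalStateConjecture-10166`), drefute seat gen 4. No Theses decl
is asserted. Six explicit models, each the registered stub S4 (`ExpandingChargeKinematics` of
`ExpandingChargeWitness.lean`, certified verbatim by `expandingChargeKinematics_iff`) with ONE hypothesis deleted or
weakened, each FALSE: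

* (W) `expandingChargeKinematics_false_without_windowLaw` — the quasi-conservation of window charges is the input the
  Cesàro velocity is extracted from;
* (I) `…_false_without_singleHoleIdentification` — additivity alone pins no charge to the kinematics (`P ≡ 0`);
* (M) `…_false_without_positiveMass` — a massless hole carries the charge `0`;
* (S) `…_false_with_bounded_separation D₀` — for EVERY `D₀`, `‖ξᵢ − ξⱼ‖ → ∞` cannot be weakened to `‖ξᵢ − ξⱼ‖ ≥ D₀`:
  a bounded binary is INVISIBLE to the whole charge interface (`R₀ := max D₀ 1` makes single-hole identification
  vacuous — spheres must be `3R`-isolated with `R ≥ R₀`);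
* (C) `…_false_without_cone` — outside the middle cone `(κ + κ²)t/2` no window or identification sphere reaches a hole;
  the sandwich `κ² < (κ + κ²)/2 < κ` is what makes every hole visible;
* (V) `…_false_without_slaving` — identification speaks of the painted `v`, the conclusion of `ξ`; only slaving ties
  them (window law verified through `inside_iff_inside_of_admissible`).

Not modelled: the speed bound `k < 1` (its deletion is exploitable only through the junk value
`(√(1 − ‖v‖²))⁻¹ = 0` at `‖v‖ ≥ 1`), continuity of `v` / smoothness of `ξ` beyond `C¹` (believed unnecessary), and
additivity (its deletion needs a two-body model with the per-hole budget `|Δ(γv)| ≤ C_δ∫R^{-7/4}`, `R ≤ d/(2δ)` — a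
real-analysis proof of its own).
-/

set_option linter.dupNamespace false

noncomputable section

namespace Summit.FinalStateConjecture.FinalStateConjecture.Theorems.InertialRecession.Negative

open Filter Set
open scoped Topology
open Literature.Geometry.Lorentzian

/-! ## §4 Load-bearing hypotheses of S4: six explicit models

Common features of the models: `N ≤ 2`, unit masses, the witness world-line `axisCentre` (or a translate of it),
painted velocity = actual velocity (`axisVel`, slaving exact) unless slaving is the dropped clause, and an abstract
charge `P` that is either identically `0` or the exact kinematic charge of the window's content. -/

/-- In `Fin 1` every index is `0`. [folklore] -/
lemma fin_one_eq (i : Fin 1) : i = 0 := Subsingleton.elim _ _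

/-- The common kinematic clauses of the one-hole models (smooth, in the cone `(1/2)²t`, separation vacuous, continuous
sub-luminal painted velocity, exact slaving) and the failure of the conclusion. [folklore] -/
lemma oneHole_kinematics :
    (∀ i : Fin 1, ContDiff ℝ ((⊤ : ℕ∞) : WithTop ℕ∞) ((fun _ : Fin 1 ↦ axisCentre) i)) ∧
    S4Cone 1 (fun _ ↦ axisCentre) (1 / 2) ∧ S4Separation 1 (fun _ ↦ axisCentre) ∧
    (∀ i : Fin 1, Continuous ((fun _ : Fin 1 ↦ axisVel) i)) ∧ S4SpeedBound 1 (fun _ ↦ axisVel) ∧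
    S4Slaving 1 (fun _ ↦ axisCentre) (fun _ ↦ axisVel) ∧ ¬ S4Conclusion 1 (fun _ ↦ axisCentre) := by
  refine ⟨fun _ ↦ contDiff_axisCentre, fun _ ↦ eventually_norm_axisCentre_le, ?_, fun _ ↦ continuous_axisVel,
    ⟨1 / 4, by norm_num, by norm_num, fun _ ↦ Eventually.of_forall norm_axisVel_le⟩, ?_, ?_⟩
  · intro i j hij
    exact absurd ((fin_one_eq i).trans (fin_one_eq j).symm) hij
  · intro i
    simp only [deriv_axisCentre, sub_self]
    exact tendsto_const_nhds
  · intro h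
    exact not_tendsto_inv_smul_axisCentre (h 0)

/-- **(W) The window law is load-bearing.** S4 with the window law DELETED is false: one hole on the witness
world-line with its EXACT kinematic window charge satisfies identification and additivity with `C = ζ = 0`, and has
no Cesàro velocity. (Any proof of S4 extracts the Cesàro velocity from the quasi-conservation of window charges.)
[folklore] -/
theorem expandingChargeKinematics_false_without_windowLaw :
    ¬ ∀ (N : ℕ) (M : Fin N → ℝ) (ξ v : Fin N → ℝ → E3) (κ : ℝ) (P : ℝ → E3 → ℝ → Fin 4 → ℝ),
      (∀ i, 0 < M i) → 0 < κ → κ < 1 → (∀ i, ContDiff ℝ ((⊤ : ℕ∞) : WithTop ℕ∞) (ξ i)) →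
      S4Cone N ξ κ → S4Separation N ξ → (∀ i, Continuous (v i)) → S4SpeedBound N v → S4Slaving N ξ v →
      S4Identification N M ξ v κ P → S4Conclusion N ξ := by
  intro h
  obtain ⟨hcd, hcone, hsep, hcont, hspeed, hslave, hnot⟩ := oneHole_kinematics
  refine hnot (h 1 (fun _ ↦ 1) (fun _ ↦ axisCentre) (fun _ ↦ axisVel) (1 / 2) (fun t c R μ ↦ kinWindowCharge t c R μ)
    (fun _ ↦ one_pos) (by norm_num) (by norm_num) hcd hcone hsep hcont hspeed hslave ?_)
  -- identification with `C = 0`, `R₀ = 1`, `T = 0`, `ζ = 0`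
  refine ⟨0, 1, 0, fun _ ↦ 0, tendsto_const_nhds, ?_, ?_⟩
  · intro t i R _ hR _ _
    have hR0 : (0 : ℝ) ≤ R := by linarith
    refine ⟨?_, fun k ↦ ?_⟩ <;> simp [kinWindowCharge, hR0]
  · intro t c R A ρ _ hR _ hinA houtA hρ μ
    by_cases h0 : (0 : Fin 1) ∈ A
    · -- `A = {0}`: the window contains the hole, and so does its sub-sphere
      have hA : A = Finset.univ := Finset.eq_univ_of_forall fun j ↦ (fin_one_eq j) ▸ h0
      subst hA
      have hin : ‖axisCentre t - c‖ ≤ R := ((hinA 0 (Finset.mem_univ _)).trans (by linarith))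
      have hρ0 : (0 : ℝ) ≤ ρ 0 := by
        have := (hρ 0 (Finset.mem_univ _)).1
        linarith
      simp [kinWindowCharge, hin, hρ0]
    · -- `A = ∅`: the hole is beyond `2R > R`
      have hA : A = ∅ := Finset.eq_empty_of_forall_notMem fun j hj ↦ h0 ((fin_one_eq j) ▸ hj)
      subst hA
      have hout : ¬ ‖axisCentre t - c‖ ≤ R := by
        have := houtA 0 (Finset.notMem_empty _)
        intro h'; linarith
      simp [kinWindowCharge, hout]

/-- **(M) Positivity of the masses is load-bearing.** S4 with `0 < Mᵢ` DELETED is false: a massless hole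
(`M = 0`) carries the charge `0`, so `P ≡ 0` satisfies identification exactly and the window law trivially.
(In the composition `0 < Mᵢ` comes from sub-extremality `|aᵢ| < Mᵢ`.) [folklore] -/
theorem expandingChargeKinematics_false_without_positiveMass :
    ¬ ∀ (N : ℕ) (M : Fin N → ℝ) (ξ v : Fin N → ℝ → E3) (κ : ℝ) (P : ℝ → E3 → ℝ → Fin 4 → ℝ),
      0 < κ → κ < 1 → (∀ i, ContDiff ℝ ((⊤ : ℕ∞) : WithTop ℕ∞) (ξ i)) →
      S4Cone N ξ κ → S4Separation N ξ → (∀ i, Continuous (v i)) → S4SpeedBound N v → S4Slaving N ξ v →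
      S4WindowLaw N ξ κ P → S4Identification N M ξ v κ P → S4Conclusion N ξ := by
  intro h
  obtain ⟨hcd, hcone, hsep, hcont, hspeed, hslave, hnot⟩ := oneHole_kinematics
  refine hnot (h 1 (fun _ ↦ 0) (fun _ ↦ axisCentre) (fun _ ↦ axisVel) (1 / 2) (fun _ _ _ _ ↦ 0)
    (by norm_num) (by norm_num) hcd hcone hsep hcont hspeed hslave ?_ ?_)
  · intro δ _ _
    exact ⟨0, 1, 0, fun _ ↦ 0, tendsto_const_nhds, fun t₁ t₂ c R _ _ _ _ μ ↦ by simp⟩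
  · exact ⟨0, 1, 0, fun _ ↦ 0, tendsto_const_nhds, fun t i R _ _ _ _ ↦ by simp,
      fun t c R A ρ _ _ _ _ _ _ μ ↦ by simp⟩

/-- **(I) Single-hole identification is load-bearing.** S4 with the single-hole identification DELETED (additivity
kept) is false: `P ≡ 0` obeys the window law and additivity exactly. (Additivity alone pins no charge to the
kinematics.) [folklore] -/
theorem expandingChargeKinematics_false_without_singleHoleIdentification :
    ¬ ∀ (N : ℕ) (M : Fin N → ℝ) (ξ v : Fin N → ℝ → E3) (κ : ℝ) (P : ℝ → E3 → ℝ → Fin 4 → ℝ),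
      (∀ i, 0 < M i) → 0 < κ → κ < 1 → (∀ i, ContDiff ℝ ((⊤ : ℕ∞) : WithTop ℕ∞) (ξ i)) →
      S4Cone N ξ κ → S4Separation N ξ → (∀ i, Continuous (v i)) → S4SpeedBound N v → S4Slaving N ξ v →
      S4WindowLaw N ξ κ P →
      (∃ (C R₀ T : ℝ) (ζ : ℝ → ℝ), Tendsto ζ atTop (𝓝 0) ∧ S4Additivity N ξ κ P C R₀ T ζ) →
      S4Conclusion N ξ := by
  intro h
  obtain ⟨hcd, hcone, hsep, hcont, hspeed, hslave, hnot⟩ := oneHole_kinematics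
  refine hnot (h 1 (fun _ ↦ 1) (fun _ ↦ axisCentre) (fun _ ↦ axisVel) (1 / 2) (fun _ _ _ _ ↦ 0)
    (fun _ ↦ one_pos) (by norm_num) (by norm_num) hcd hcone hsep hcont hspeed hslave ?_ ?_)
  · intro δ _ _
    exact ⟨0, 1, 0, fun _ ↦ 0, tendsto_const_nhds, fun t₁ t₂ c R _ _ _ _ μ ↦ by simp⟩
  · exact ⟨0, 1, 0, fun _ ↦ 0, tendsto_const_nhds, fun t c R A ρ _ _ _ _ _ _ μ ↦ by simp⟩

/-- **(S) Pairwise separation `→ ∞` is load-bearing, and NO bounded separation suffices.** For every `D₀`, S4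
with `‖ξᵢ - ξⱼ‖ → ∞` replaced by `‖ξᵢ(t) - ξⱼ(t)‖ ≥ D₀` for all `t` is false: a rigid binary at distance
`d = max D₀ 1` on the witness world-line, with `P ≡ 0` and `R₀ := d` — identification only speaks of spheres of
radius `R ≥ R₀` that are `3R`-isolated, so a bounded binary is INVISIBLE to the whole charge interface (window law
and additivity hold trivially, single-hole identification vacuously). Consequence for any proof: the induction over
clear scales starts strictly above the identification threshold, and bound sub-systems are outside S4's reach by
design. [folklore] -/
theorem expandingChargeKinematics_false_with_bounded_separation (D₀ : ℝ) :
    ¬ ∀ (N : ℕ) (M : Fin N → ℝ) (ξ v : Fin N → ℝ → E3) (κ : ℝ) (P : ℝ → E3 → ℝ → Fin 4 → ℝ),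
      (∀ i, 0 < M i) → 0 < κ → κ < 1 → (∀ i, ContDiff ℝ ((⊤ : ℕ∞) : WithTop ℕ∞) (ξ i)) →
      S4Cone N ξ κ → (∀ i j, i ≠ j → ∀ t, D₀ ≤ ‖ξ i t - ξ j t‖) → (∀ i, Continuous (v i)) →
      S4SpeedBound N v → S4Slaving N ξ v → S4WindowLaw N ξ κ P → S4Identification N M ξ v κ P →
      S4Conclusion N ξ := by
  intro h
  set d : ℝ := max D₀ 1 with hd
  have hd1 : 1 ≤ d := le_max_right _ _
  have hd0 : 0 < d := one_pos.trans_le hd1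
  -- the binary: hole 0 on the witness world-line, hole 1 rigidly translated by `d • e₀`
  set ξ : Fin 2 → ℝ → E3 := fun i t ↦ axisCentre t + ((i : ℕ) : ℝ) • (d • axis0) with hξ
  have hξ0 : ξ 0 = axisCentre := by funext t; simp [hξ]
  have hξ1 : ∀ t, ξ 1 t = axisCentre t + d • axis0 := fun t ↦ by simp [hξ]
  have hdist : ∀ i j : Fin 2, i ≠ j → ∀ t, ‖ξ i t - ξ j t‖ = d := by
    intro i j hij t
    fin_cases i <;> fin_cases j
    · exact absurd rfl hij
    · simp [hξ, norm_smul, abs_of_pos hd0]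
    · simp [hξ, norm_smul, abs_of_pos hd0]
    · exact absurd rfl hij
  have hderiv : ∀ i t, deriv (ξ i) t = axisVel t := by
    intro i t
    have : HasDerivAt (ξ i) (axisVel t + 0) t := (hasDerivAt_axisCentre t).add (hasDerivAt_const _ _)
    simpa using this.deriv
  refine not_tendsto_inv_smul_axisCentre ?_
  rw [← hξ0]
  refine h 2 (fun _ ↦ 1) ξ (fun _ ↦ axisVel) (3 / 4) (fun _ _ _ _ ↦ 0) (fun _ ↦ one_pos) (by norm_num)
    (by norm_num) (fun i ↦ ?_) (fun i ↦ ?_) (fun i j hij t ↦ ?_) (fun _ ↦ continuous_axisVel)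
    ⟨1 / 4, by norm_num, by norm_num, fun _ ↦ Eventually.of_forall norm_axisVel_le⟩ (fun i ↦ ?_) ?_ ?_ 0
  · -- smooth
    exact contDiff_axisCentre.add contDiff_const
  · -- cone `(3/4)² t`: `‖ξᵢ t‖ ≤ t/4 + d ≤ 9t/16` for `t ≥ 16d/5`
    filter_upwards [eventually_norm_axisCentre_le, eventually_ge_atTop (16 * d / 5)] with t ht ht'
    calc ‖ξ i t‖ ≤ ‖axisCentre t‖ + ‖((i : ℕ) : ℝ) • (d • axis0)‖ := norm_add_le _ _
      _ ≤ (1 / 2) ^ 2 * t + d := by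
          gcongr
          fin_cases i <;> simp [norm_smul, abs_of_pos hd0, hd0.le]
      _ ≤ (3 / 4) ^ 2 * t := by nlinarith
  · -- bounded separation `≥ D₀`
    rw [hdist i j hij t]
    exact le_max_left _ _
  · -- slaving (exact)
    simp only [hderiv, sub_self]
    exact tendsto_const_nhds
  · -- window law for `P ≡ 0`
    intro δ _ _
    exact ⟨0, 1, 0, fun _ ↦ 0, tendsto_const_nhds, fun t₁ t₂ c R _ _ _ _ μ ↦ by simp⟩
  · -- identification with `R₀ := d`: single-hole spheres must be `3R`-isolated with `R ≥ d` — impossible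
    refine ⟨0, d, 0, fun _ ↦ 0, tendsto_const_nhds, ?_, fun t c R A ρ _ _ _ _ _ _ μ ↦ by simp⟩
    intro t i R _ hR _ hiso
    exfalso
    obtain ⟨j, hj⟩ : ∃ j : Fin 2, j ≠ i := ⟨i + 1, by fin_cases i <;> decide⟩
    have := hiso j hj
    rw [hdist i j hj.symm t] at this
    linarith

/-- **(C) The cone clause `‖ξᵢ‖ ≤ κ²t` is load-bearing.** S4 with the cone clause DELETED is false: a hole on the far
world-line (norm `≥ 3t/8 = (κ + κ²)t/2`, `κ = 1/2`) is outside the middle cone where windows and identification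
spheres live, so `P ≡ 0` satisfies every remaining clause. (The sandwich `κ² < (κ + κ²)/2 < κ` is what makes every
hole visible to the charge interface.) [folklore] -/
theorem expandingChargeKinematics_false_without_cone :
    ¬ ∀ (N : ℕ) (M : Fin N → ℝ) (ξ v : Fin N → ℝ → E3) (κ : ℝ) (P : ℝ → E3 → ℝ → Fin 4 → ℝ),
      (∀ i, 0 < M i) → 0 < κ → κ < 1 → (∀ i, ContDiff ℝ ((⊤ : ℕ∞) : WithTop ℕ∞) (ξ i)) →
      S4Separation N ξ → (∀ i, Continuous (v i)) → S4SpeedBound N v → S4Slaving N ξ v →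
      S4WindowLaw N ξ κ P → S4Identification N M ξ v κ P → S4Conclusion N ξ := by
  intro h
  refine not_tendsto_inv_smul_farCentre (h 1 (fun _ ↦ 1) (fun _ ↦ farCentre) (fun _ ↦ farVel) (1 / 2)
    (fun _ _ _ _ ↦ 0) (fun _ ↦ one_pos) (by norm_num) (by norm_num) (fun _ ↦ ?_) ?_
    (fun _ ↦ ?_) ⟨5 / 8, by norm_num, by norm_num, fun _ ↦ Eventually.of_forall norm_farVel_le⟩ (fun _ ↦ ?_) ?_ ?_ 0)
  · exact (((contDiff_id.div_const 2).add (contDiff_centre _)).smul contDiff_const)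
  · intro i j hij
    exact absurd ((fin_one_eq i).trans (fin_one_eq j).symm) hij
  · exact ((continuous_const.add (continuous_const.mul continuous_vel)).smul continuous_const)
  · simp only [fun t ↦ (hasDerivAt_farCentre t).deriv, sub_self]
    exact tendsto_const_nhds
  · intro δ _ _
    exact ⟨0, 1, 0, fun _ ↦ 0, tendsto_const_nhds, fun t₁ t₂ c R _ _ _ _ μ ↦ by simp⟩
  · refine ⟨0, 1, 0, fun _ ↦ 0, tendsto_const_nhds, ?_, fun t c R A ρ _ _ _ _ _ _ μ ↦ by simp⟩
    intro t i R ht hR hmid _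
    exfalso
    have := le_norm_farCentre ht
    norm_num at hmid
    linarith

/-- **(V) Slaving `ξ̇ᵢ - vᵢ → 0` is load-bearing.** S4 with the slaving clause DELETED is false: paint the witness
world-line with the velocity `v ≡ 0`; the window charge of a unit mass at rest, `(1,0,0,0)·𝟙[inside]`, satisfies
identification exactly and — by `inside_iff_inside_of_admissible` (the inside set is constant along admissible
paths) — the window law with `C = η = 0`. (Identification speaks of `v`, the conclusion of `ξ`; only slaving ties
them.) [folklore] -/
theorem expandingChargeKinematics_false_without_slaving :
    ¬ ∀ (N : ℕ) (M : Fin N → ℝ) (ξ v : Fin N → ℝ → E3) (κ : ℝ) (P : ℝ → E3 → ℝ → Fin 4 → ℝ),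
      (∀ i, 0 < M i) → 0 < κ → κ < 1 → (∀ i, ContDiff ℝ ((⊤ : ℕ∞) : WithTop ℕ∞) (ξ i)) →
      S4Cone N ξ κ → S4Separation N ξ → (∀ i, Continuous (v i)) → S4SpeedBound N v →
      S4WindowLaw N ξ κ P → S4Identification N M ξ v κ P → S4Conclusion N ξ := by
  intro h
  obtain ⟨hcd, hcone, hsep, -, -, -, hnot⟩ := oneHole_kinematics
  refine hnot (h 1 (fun _ ↦ 1) (fun _ ↦ axisCentre) (fun _ _ ↦ 0) (1 / 2) restWindowCharge
    (fun _ ↦ one_pos) (by norm_num) (by norm_num) hcd hcone hsep (fun _ ↦ continuous_const)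
    ⟨0, le_rfl, one_pos, fun _ ↦ Eventually.of_forall fun _ ↦ by simp⟩ ?_ ?_)
  · -- window law with `C = 0`, `R₀ = 1`, `T = 0`, `η = 0`: the charge is constant along admissible paths
    intro δ hδ _
    refine ⟨0, 1, 0, fun _ ↦ 0, tendsto_const_nhds, fun t₁ t₂ c R _ h12 hlip hadm μ ↦ ?_⟩
    have key : (‖axisCentre t₁ - c t₁‖ ≤ R t₁ ↔ ‖axisCentre t₂ - c t₂‖ ≤ R t₂) :=
      inside_iff_inside_of_admissible continuous_axisCentre hδ one_pos h12 hlip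
        fun s hs ↦ ⟨(hadm s hs).1, (hadm s hs).2.2 0⟩
    have : restWindowCharge t₂ (c t₂) (R t₂) μ = restWindowCharge t₁ (c t₁) (R t₁) μ := by
      simp only [restWindowCharge, key]
    simp [this]
  · -- identification, exact (`v = 0`, `γ = 1`)
    refine ⟨0, 1, 0, fun _ ↦ 0, tendsto_const_nhds, ?_, ?_⟩
    · intro t i R _ hR _ _
      have hR0 : (0 : ℝ) ≤ R := by linarith
      refine ⟨?_, fun k ↦ ?_⟩ <;> simp [restWindowCharge, hR0]
    · intro t c R A ρ _ hR _ hinA houtA hρ μ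
      by_cases h0 : (0 : Fin 1) ∈ A
      · have hA : A = Finset.univ := Finset.eq_univ_of_forall fun j ↦ (fin_one_eq j) ▸ h0
        subst hA
        have hin : ‖axisCentre t - c‖ ≤ R := ((hinA 0 (Finset.mem_univ _)).trans (by linarith))
        have hρ0 : (0 : ℝ) ≤ ρ 0 := by
          have := (hρ 0 (Finset.mem_univ _)).1
          linarith
        simp [restWindowCharge, hin, hρ0]
      · have hA : A = ∅ := Finset.eq_empty_of_forall_notMem fun j hj ↦ h0 ((fin_one_eq j) ▸ hj)
        subst hA
        have hout : ¬ ‖axisCentre t - c‖ ≤ R := by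
          have := houtA 0 (Finset.notMem_empty _)
          intro h'; linarith
        simp [restWindowCharge, hout]

end Summit.FinalStateConjecture.FinalStateConjecture.Theorems.InertialRecession.Negative

end
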